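import Summits.HodgeConjecture.HodgeConjecture.Theorems.CurveNetMordellWeilDefs
import Summits.HodgeConjecture.HodgeConjecture.Theorems.CurveNetMordellWeilVerticalSupportMiddleHardness
import Literature.AlgebraicGeometry.HodgeTheory.PencilStepBelowMiddleHolds
import Literature.AlgebraicGeometry.HodgeTheory.HardLefschetzNFoldHolds
import Literature.AlgebraicGeometry.HodgeTheory.LefschetzOneOneHolds
import Literature.AlgebraicGeometry.HodgeTheory.SaitoGrFDeRhamCurveNetHolds
import Literature.AlgebraicGeometry.HodgeTheory.HodgeRiemannPolarizabilityProofs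
import Literature.AlgebraicGeometry.HodgeTheory.SupportedClassesOfChowZeroRankOne

/-!
# Route CurveNetMordellWeil, crux `VerticalSupportMiddle` (stmt-HodgeConjecture-2782): the level-wise
# reduction of the Hodge conjecture to its middle-dimensional step, and the regime split (helpers, `--supports`)

Line `regime-split-middle-step` of the crux (strategist skeleton
`Cruxes/VerticalSupportMiddle/Lines/regime_split_middle_step.lean`, 2026-08-17; definitions in
`CurveNetMordellWeilDefs`, namespace `…Theorems.RegimeSplit`). Everything in this file is PROVED from
theorems of the tree (no named fact is taken as a hypothesis):

* `supportedHodgeClasses_algebraic_of_hodgeBelowDim` — given the Hodge conjecture in all dimensions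
  `< n` (`HodgeBelowDim n`), a rational `(p,p)`-class of coniveau `≥ 1` on a smooth projective `n`-fold
  is algebraic (Deligne, Hodge III Cor. 8.2.8 + Voisin 2025 Cor. 2.12, both DISCHARGED in the tree:
  `Deligne1974_…_holds`, `Voisin2025_…_holds`; assembled by the landed
  `supportedHodgeClass_mem_algebraicClasses_of_codim_lt`).
* `middleStepFor_of_coniveau` — to prove the middle step on a class of `2q`-folds it suffices to land
  every rational `(q,q)`-class in `algebraic ⊔ span{rational (q,q) of coniveau ≥ 1}`.
* `hodgeConjecture_of_middleStep` (registered sub-goal) — **the Hodge conjecture follows from its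
  level-wise middle step** "`∀ q ≥ 2`, HC(all dims `< 2q`) ⟹ HC^q(`2q`-folds)": strong induction on the
  dimension over the tree's PROVED Lefschetz-pencil step below the middle
  (`mem_algebraicClasses_of_two_mul_le`), hard Lefschetz above it
  (`HardLefschetzNFold.mem_algebraicClasses_of_lt_holds`), Lefschetz `(1,1)`
  (`lefschetzOneOne_rational_holds`) and Hodge models (`nonempty_hodgeModel_holds`).
* `middleStep_of_regimes`, `verticalSupportMiddle_of_regimes` — the two regimes of the Bloch–Srinivas
  CH₀-dichotomy (`MiddleStepFor ChowZeroDegenerate`, `MiddleStepFor (¬ ChowZeroDegenerate ·)`) give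
  the middle step on all `2q`-folds, whence HC, whence the crux `VerticalSupportMiddle`
  (`verticalSupportMiddle_of_hodgeConjecture`, landed) — the glue of the strategist's split kit.
* `middleStepFor_chowRankLEOne_of_gysin` — a second provable regime: the middle step for `2q`-folds
  with `CH₀(X)_ℚ = ℚ`, granted ANY Gysin / cycle-class formalism (coniveau `≥ 1` of all of `H^{2q}`,
  Voisin 2025 Cor. 5.7, + descent).
* Sanity: `regimes_of_hodgeConjecture` (both regimes are HC-true), `coniveau_one_odd_of_hodgeBelowDim`
  (under the stubs' antecedent the parent's Stein artefact `OddConiveauOne` is free below dimension `2q`).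

The CH₀-degenerate regime itself (Voisin II Prop. 10.26 in every even dimension, granted a Gysin /
cycle-class formalism) is the sibling file `CurveNetMordellWeilVerticalSupportMiddleChowDegenerate`.

## References

* [KerrPearlstein2011] M. Kerr, G. Pearlstein, §3.1 (reduction to the middle dimension).
* [BrosnanFangNiePearlstein2009] P. Brosnan, H. Fang, Z. Nie, G. Pearlstein, §6 Lemma 48.
* [DeligneHodgeIII1974] P. Deligne, Théorie de Hodge III, Cor. 8.2.8.
* [Voisin2025] C. Voisin, J. Open Math. Probl. 1 (2025), Cor. 2.12, Thm. 4.4.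
* [VoisinHodgeII2003] C. Voisin, Hodge Theory and Complex Algebraic Geometry II, Thm. 10.17,
  Cor. 10.21, Prop. 10.26.
* [DecataldoMigliorini2009] M. A. de Cataldo, L. Migliorini, §4 Prop. 4.5 (pencil step).
-/

noncomputable section

-- `Summit.HodgeConjecture.HodgeConjecture.Theorems` is the mandated namespace (single-problem summit:
-- Problem = Summit), which `linter.dupNamespace` flags on every declaration; the lakefile turns the
-- linter off tree-wide (weak option), restated here so stand-alone elaboration is warning-free too.
set_option linter.dupNamespace false

open CategoryTheory AlgebraicGeometry
open Literature.AlgebraicGeometry Literature.AlgebraicGeometry.Motives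
  Literature.AlgebraicGeometry.HodgeTheory Literature.AlgebraicTopology.SingularHomology
open Summit.HodgeConjecture.HodgeConjecture.Theses.CurveNetMordellWeil (VerticalSupportMiddle)

namespace Summit.HodgeConjecture.HodgeConjecture.Theorems

open RegimeSplit

/-! ### Coniveau-one Hodge classes are algebraic under the dimension hypothesis -/

/-- **Supported rational Hodge classes are algebraic, given HC in lower dimensions** (Deligne,
Hodge III Cor. 8.2.8 + Voisin 2025 Cor. 2.12, both discharged in the tree; assembled by
`supportedHodgeClass_mem_algebraicClasses_of_codim_lt`): on a smooth projective `n`-fold, a rational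
`(p,p)`-class of coniveau `≥ 1` is algebraic as soon as the Hodge conjecture holds for all smooth
projective varieties of dimension `< n`. [cite: DeligneHodgeIII1974, Cor. 8.2.8]
[cite: Voisin2025, Cor. 2.12] -/
theorem supportedHodgeClasses_algebraic_of_hodgeBelowDim {n : ℕ} (ih : HodgeBelowDim n)
    {X : SchemeOver ℂ} (hX : IsSmoothProjective n X) {p : ℕ} (c : complexBetti X (2 * p))
    (hc : IsRationalClass c) (hpp : IsOfHodgeType n X (2 * p) p p c)
    (hsupp : c ∈ supportedClasses X (2 * p) 1) : c ∈ algebraicClasses X p :=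
  supportedHodgeClass_mem_algebraicClasses_of_codim_lt
    Deligne1974_ker_restrictCompl_eq_iSup_range_complexGysin_holds
    Voisin2025_hodgeClass_lift_complexGysin_holds hX
    (fun _ d _ hm _ hY β hβ hβ' ↦ ih hm hY d β hβ hβ') c hc hpp hsupp

/-- The coniveau form of the middle step on a class of `2q`-folds suffices: it is enough to put every
rational `(q,q)`-class into `algebraicClasses ⊔ span{rational (q,q) of coniveau ≥ 1}` (the second
summand is algebraic by `supportedHodgeClasses_algebraic_of_hodgeBelowDim`). [cite: Voisin2025, Cor. 2.12] -/
theorem middleStepFor_of_coniveau (P : ∀ _ : SchemeOver ℂ, Prop)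
    (h : ∀ ⦃q : ℕ⦄ ⦃X : SchemeOver ℂ⦄, 2 ≤ q → IsSmoothProjective (2 * q) X → HodgeBelowDim (2 * q) →
      P X → Submodule.span ℂ {c : complexBetti X (2 * q) |
          IsRationalClass c ∧ IsOfHodgeType (2 * q) X (2 * q) q q c} ≤
        algebraicClasses X q ⊔ Submodule.span ℂ {c : complexBetti X (2 * q) |
          IsRationalClass c ∧ IsOfHodgeType (2 * q) X (2 * q) q q c ∧ c ∈ supportedClasses X (2 * q) 1}) :
    MiddleStepFor P := by
  intro q X hq hX ih hP c hc hh
  have hmem := h hq hX ih hP (Submodule.subset_span ⟨hc, hh⟩)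
  have hle : algebraicClasses X q ⊔ Submodule.span ℂ {c : complexBetti X (2 * q) |
      IsRationalClass c ∧ IsOfHodgeType (2 * q) X (2 * q) q q c ∧ c ∈ supportedClasses X (2 * q) 1} ≤
      algebraicClasses X q := by
    refine sup_le le_rfl (Submodule.span_le.2 ?_)
    rintro c' ⟨hc', hh', hs'⟩
    exact supportedHodgeClasses_algebraic_of_hodgeBelowDim ih hX c' hc' hh' hs'
  exact hle hmem

/-! ### The level-wise reduction of the Hodge conjecture to its middle step -/

/-- The two regimes of the CH₀-dichotomy give the middle step on ALL `2q`-folds (classical case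
split on `ChowZeroDegenerate X`). [cite: VoisinHodgeII2003, Cor. 10.21 and Thm. 10.17] -/
theorem middleStep_of_regimes (hD : MiddleStepFor ChowZeroDegenerate)
    (hH : MiddleStepFor fun X ↦ ¬ ChowZeroDegenerate X) : MiddleStepFor fun _ ↦ True := by
  intro q X hq hX ih _ c hc hh
  by_cases hW : ChowZeroDegenerate X
  · exact hD hq hX ih hW c hc hh
  · exact hH hq hX ih hW c hc hh

/-- **HC below the middle at dimension `n` from HC in all dimensions `< n`** — the tree's proved
Lefschetz-pencil step `mem_algebraicClasses_of_two_mul_le`. [cite: DecataldoMigliorini2009, §4 proof of Prop. 4.5] -/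
theorem hodge_below_middle_of_hodgeBelowDim {n : ℕ} (ih : HodgeBelowDim n) {X : SchemeOver ℂ}
    (hX : IsSmoothProjective n X) (p : ℕ) (hp : 2 * p < n) (c : complexBetti X (2 * p))
    (hc : IsRationalClass c) (hh : IsOfHodgeType n X (2 * p) p p c) : c ∈ algebraicClasses X p := by
  obtain ⟨m, rfl⟩ : ∃ m, n = m + 1 := ⟨n - 1, by omega⟩
  exact mem_algebraicClasses_of_two_mul_le hX (fun Y hY q c hc hh ↦ ih (lt_add_one m) hY q c hc hh)
    p c (by omega) hc hh

/-- **HC in all codimensions at dimension `n` from HC in dimensions `< n` and the middle step**: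
pencil step below the middle, hard Lefschetz above it (`HardLefschetzNFold.mem_algebraicClasses_of_lt_holds`),
the middle step / Lefschetz `(1,1)` / `algebraicClasses_zero` in the middle.
[cite: KerrPearlstein2011, §3.1] [cite: BrosnanFangNiePearlstein2009, §6 Lemma 48] -/
theorem hodge_of_hodgeBelowDim_of_middleStep {n : ℕ} (ih : HodgeBelowDim n)
    (mid : MiddleStepFor fun _ ↦ True) {X : SchemeOver ℂ}
    (hX : IsSmoothProjective n X) (p : ℕ) (c : complexBetti X (2 * p)) (hc : IsRationalClass c)
    (hh : IsOfHodgeType n X (2 * p) p p c) : c ∈ algebraicClasses X p := by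
  rcases lt_trichotomy (2 * p) n with hlt | heq | hgt
  · exact hodge_below_middle_of_hodgeBelowDim ih hX p hlt c hc hh
  · rcases Nat.lt_or_ge p 2 with hp2 | hp2
    · interval_cases p
      · rw [algebraicClasses_zero]
        exact Submodule.mem_top
      · exact lefschetzOneOne_rational_holds hX c hc hh
    · subst heq
      exact mid hp2 hX ih trivial c hc hh
  · refine HardLefschetzNFold.mem_algebraicClasses_of_lt_holds hX hgt (fun c' hc' hh' ↦ ?_) c hc hh
    rcases Nat.lt_or_ge (2 * (n - p)) n with hlow | hzero
    · exact hodge_below_middle_of_hodgeBelowDim ih hX (n - p) hlow c' hc' hh'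
    · have h0 : n - p = 0 := by omega
      generalize n - p = k at c' hh' h0 ⊢
      subst h0
      rw [algebraicClasses_zero]
      exact Submodule.mem_top

/-- **LEVEL-WISE REDUCTION OF THE HODGE CONJECTURE TO ITS MIDDLE-DIMENSIONAL STEP** (registered
sub-goal of stmt-HodgeConjecture-2782): if for every `q ≥ 2` the Hodge conjecture for all smooth
projective varieties of dimension `< 2q` implies that rational `(q,q)`-classes are algebraic on every
smooth projective `2q`-fold, then the Hodge conjecture holds — strong induction on the dimension
(`hodge_of_hodgeBelowDim_of_middleStep`; Hodge models by `nonempty_hodgeModel_holds`).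
[cite: KerrPearlstein2011, §3.1] [cite: BrosnanFangNiePearlstein2009, §6 Lemma 48] -/
theorem hodgeConjecture_of_middleStep : MiddleStepFor (fun _ ↦ True) → _root_.HodgeConjecture := by
  intro mid
  have main : ∀ n : ℕ, HodgeBelowDim (n + 1) := by
    intro n
    induction n using Nat.strong_induction_on with
    | _ n ihn =>
      intro n' X hn' hX p c hc hh
      have ih : HodgeBelowDim n' := by
        intro k Y hk hY p' c' hc' hh'
        rcases Nat.eq_zero_or_pos n with h0 | hpos
        · omega
        · exact ihn (n - 1) (by omega) (by omega) hY p' c' hc' hh'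
      exact hodge_of_hodgeBelowDim_of_middleStep ih mid hX p c hc hh
  intro n X hX
  exact ⟨(nonempty_hodgeModel_holds (n := n) (X := X)).nonempty hX,
    fun p c hc hh ↦ main n (lt_add_one n) hX p c hc hh⟩

/-- The crux from the full middle step: `hodgeConjecture_of_middleStep`, then
`verticalSupportMiddle_of_hodgeConjecture` (the Hodge conjecture implies the crux as typed).
[cite: KerrPearlstein2011, §3.1] -/
theorem verticalSupportMiddle_of_middleStep (mid : MiddleStepFor fun _ ↦ True) : VerticalSupportMiddle :=
  verticalSupportMiddle_of_hodgeConjecture (hodgeConjecture_of_middleStep mid)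

/-- **The glue of the regime split** (strategist split kit): the heart (CH₀-non-degenerate `2q`-folds)
and the provable regime (CH₀-degenerate `2q`-folds) together give the crux `VerticalSupportMiddle`.
[cite: VoisinHodgeII2003, Cor. 10.21 and Thm. 10.17] [cite: KerrPearlstein2011, §3.1] -/
theorem verticalSupportMiddle_of_regimes (hH : MiddleStepFor fun X ↦ ¬ ChowZeroDegenerate X)
    (hD : MiddleStepFor ChowZeroDegenerate) : VerticalSupportMiddle :=
  verticalSupportMiddle_of_middleStep (middleStep_of_regimes hD hH)

/-! ### Pointwise form of the reduction, and the unconditional `HodgeBelowDim 4` -/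

/-- **HC in all codimensions on ONE `n`-fold from HC in dimensions `< n` and the middle case on that
variety**: below the middle by the pencil step, above it by hard Lefschetz, in the middle by the
hypothesis `mid` (only consulted when `n = 2q`, `q ≥ 2`), Lefschetz `(1,1)` or `algebraicClasses_zero`.
[cite: KerrPearlstein2011, §3.1] [cite: BrosnanFangNiePearlstein2009, §6 Lemma 48] -/
theorem hodge_of_hodgeBelowDim_of_middle {n : ℕ} (ih : HodgeBelowDim n) {X : SchemeOver ℂ}
    (hX : IsSmoothProjective n X)
    (mid : ∀ q : ℕ, 2 ≤ q → 2 * q = n → ∀ c : complexBetti X (2 * q), IsRationalClass c →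
      IsOfHodgeType n X (2 * q) q q c → c ∈ algebraicClasses X q)
    (p : ℕ) (c : complexBetti X (2 * p)) (hc : IsRationalClass c)
    (hh : IsOfHodgeType n X (2 * p) p p c) : c ∈ algebraicClasses X p := by
  rcases lt_trichotomy (2 * p) n with hlt | heq | hgt
  · exact hodge_below_middle_of_hodgeBelowDim ih hX p hlt c hc hh
  · rcases Nat.lt_or_ge p 2 with hp2 | hp2
    · interval_cases p
      · rw [algebraicClasses_zero]
        exact Submodule.mem_top
      · exact lefschetzOneOne_rational_holds hX c hc hh
    · exact mid p hp2 heq c hc hh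
  · refine HardLefschetzNFold.mem_algebraicClasses_of_lt_holds hX hgt (fun c' hc' hh' ↦ ?_) c hc hh
    rcases Nat.lt_or_ge (2 * (n - p)) n with hlow | hzero
    · exact hodge_below_middle_of_hodgeBelowDim ih hX (n - p) hlow c' hc' hh'
    · have h0 : n - p = 0 := by omega
      generalize n - p = k at c' hh' h0 ⊢
      subst h0
      rw [algebraicClasses_zero]
      exact Submodule.mem_top

/-- **The Hodge conjecture holds, unconditionally, for all smooth projective complex varieties of
dimension `≤ 3`** (`HodgeBelowDim 4`) — the tree's theorem `hodgeClasses_algebraic_of_dim_le_three_holds`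
(Lefschetz `(1,1)`, its hard-Lefschetz dual, points and the fundamental class), in the spelling of the
induction hypothesis: the middle step at `q = 2` (fourfolds) has its antecedent for free.
[cite: VoisinHodgeI2002, Thm. 6.25 and Thm. 11.30] -/
theorem hodgeBelowDim_four : HodgeBelowDim 4 :=
  fun _ _ hn hY p c hc hh ↦ hodgeClasses_algebraic_of_dim_le_three_holds (by omega) hY p c hc hh

/-- **`HodgeConjectureFor n X` for one variety from HC below and its middle case** (anti-vacuity conjunct
by `nonempty_hodgeModel_holds`). [cite: Deligne2000, §1] -/
theorem hodgeConjectureFor_of_hodgeBelowDim_of_middle {n : ℕ} (ih : HodgeBelowDim n) {X : SchemeOver ℂ}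
    (hX : IsSmoothProjective n X)
    (mid : ∀ q : ℕ, 2 ≤ q → 2 * q = n → ∀ c : complexBetti X (2 * q), IsRationalClass c →
      IsOfHodgeType n X (2 * q) q q c → c ∈ algebraicClasses X q) :
    HodgeConjectureFor n X :=
  ⟨(nonempty_hodgeModel_holds (n := n) (X := X)).nonempty hX,
    fun p c hc hh ↦ hodge_of_hodgeBelowDim_of_middle ih hX mid p c hc hh⟩

/-! ### A second provable regime: `CH₀(X)_ℚ = ℚ`, granted a Gysin / cycle-class formalism -/

/-- **The middle step for `2q`-folds with `dim_ℚ CH₀(X) ⊗ ℚ ≤ 1` (`Motives.ChowRankLEOneUpTo X 0`),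
granted ANY Gysin / cycle-class formalism `G`** (no Hodge compatibility needed): all of
`H^{2q}(X(ℂ); ℂ)` has coniveau `≥ 1` (`GysinFormalism.supportedClasses_eq_top_of_chowRankLEOneUpTo_zero`,
Bloch–Srinivas / Voisin 2025 Cor. 5.7, from the tree's proved generalised decomposition of the
diagonal), so every rational `(q,q)`-class is algebraic by descent + the induction hypothesis
(`supportedHodgeClasses_algebraic_of_hodgeBelowDim`). Covers, given the Chow-theoretic input, cubic /
quartic / quintic `2q`-folds and every rationally connected `2q`-fold.
[cite: Voisin2025, Cor. 5.7] [cite: BlochSrinivas1983, Thm. 1] -/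
theorem middleStepFor_chowRankLEOne_of_gysin (G : GysinFormalism) :
    MiddleStepFor fun X ↦ ChowRankLEOneUpTo X 0 := by
  intro q X hq hX ih hCH c hc hh
  refine supportedHodgeClasses_algebraic_of_hodgeBelowDim ih hX c hc hh ?_
  rw [G.supportedClasses_eq_top_of_chowRankLEOneUpTo_zero hX hCH (by omega)]
  exact Submodule.mem_top

/-! ### Sanity: the regimes are HC-true, and the Stein artefact is free under the antecedent -/

/-- The Hodge conjecture implies the middle step on every class of `2q`-folds (so both regimes are
HC-true and not refutable short of `¬HC`). [cite: Deligne2000, §1] -/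
theorem regimes_of_hodgeConjecture (hHC : _root_.HodgeConjecture) (P : ∀ _ : SchemeOver ℂ, Prop) :
    MiddleStepFor P :=
  fun _ _ _ hX _ _ c hc hh ↦ (hHC hX).2 _ c hc hh

/-- Under the stubs' antecedent the parent's Stein component `OddConiveauOne` is free below dimension
`2q`: HC in dimensions `< 2q` gives coniveau `≥ 1` (indeed `≥ p`) for rational `(p,p)`-classes on
`(2p+1)`-folds of dimension `< 2q`, `p ≥ 1`. [cite: Deligne2000, §1] -/
theorem coniveau_one_odd_of_hodgeBelowDim {q : ℕ} (ih : HodgeBelowDim (2 * q)) {p : ℕ} (hp : 1 ≤ p)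
    (hpq : 2 * p + 1 < 2 * q) {B : SchemeOver ℂ} (hB : IsSmoothProjective (2 * p + 1) B)
    (c : complexBetti B (2 * p)) (hc : IsRationalClass c) (hpp : IsOfHodgeType (2 * p + 1) B (2 * p) p p c) :
    c ∈ supportedClasses B (2 * p) 1 :=
  supportedClasses_mono B (2 * p) hp (ih hpq hB p c hc hpp)

end Summit.HodgeConjecture.HodgeConjecture.Theorems

end
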